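import Literature.AlgebraicGeometry.Resolution.HenselizedFunctionFieldsImmediate
import Mathlib.Algebra.CharP.Lemmas
import Mathlib.Algebra.CharP.Algebra
import Mathlib.Data.Fintype.Pigeonhole
import Mathlib.LinearAlgebra.Finsupp.LinearCombination
import HarnessLib

/-!
# Lifted Frobenius-closed bases (Kuhlmann 2010, §4.2: Lemmas 4.7, 4.8, 4.10)

Topic: `Literature/AlgebraicGeometry/Resolution` (valued function fields). Third layer of the
decomposition of the named fact `Kuhlmann2010NormalDegreePDefectless`
(`HenselizedFunctionFields.lean`), below `Kuhlmann2010Prop41RTEqualChar`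
(`NormalDegreePDefectlessGalois.lean`) = F.-V. Kuhlmann, *Elimination of ramification I: The
generalized stability theorem*, Trans. AMS 362 (2010) 5697–5727 = arXiv:1003.5678, Prop. 4.1 in
the residue-transcendental case of equal characteristic, whose printed proof (Prop. 4.12) runs in
a subring `R ⊆ F` carrying a lifting of a Frobenius-closed basis (§4.2):

> **Lemma 4.7.** Let `(F|K,v)` be a henselized inertially generated function field of rank `1`
> and transcendence degree `1` with a residue-transcendental generator. Further, assume that `K̄`
> is perfect of characteristic `p > 0` and relatively algebraically closed in `F̄`, and that `K`
> is of arbitrary characteristic and closed under `p`-th roots. Then `F` contains a subring `R`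
> which satisfies:
> (LFC1) `R` contains `K` and its quotient field Quot(`R`) is dense in `F`,
> (LFC2) `R` admits a valuation basis `𝓑 = {uⱼ | j ∈ J}` over `K` of elements of value `0` and
> containing the element `1`, whose residues `ūⱼ`, `j ∈ J`, form a basis of `F̄|K̄`,
> (LFC3) `𝓑` is Frobenius-closed.
>
> **Lemma 4.8.** Assume that Properties (LFC2) and (LFC3) hold. Then: a) The basis `𝓑̄` of `F̄|K̄`
> consisting of all `ūⱼ`, `j ∈ J`, is also Frobenius-closed. If `ū_m = ū_n^p` then `u_m = u_n^p`.
> b) If the sum `∑_{i∈I} c̄ᵢūᵢ`, `c̄ᵢ ∈ K̄`, `I ⊂ J` finite is a `p`-th power, then for every `i ∈ I`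
> with `c̄ᵢ ≠ 0`, the basis element `ūᵢ` is a `p`-th power of a basis element. c) If
> `0 ≠ ϑ^p - ϑ = ∑_{i∈I} c̄ᵢūᵢ`, … then there is some `i ∈ I` with `c̄ᵢ ≠ 0` such that the basis
> element `ūᵢ` is a `p`-th power of a basis element.

## Content

* `exists_apply_eq_of_linearCombination_eq_pow`, `exists_apply_eq_of_linearCombination_eq_pow_sub`
  — Lemma 4.8 (b), (c) in abstract form, for a linearly independent Frobenius-closed family in
  a field of characteristic `p` (uniqueness of coefficients; for (c), "left to the reader" in
  the source, a finiteness argument along the Frobenius orbit). PROVED.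
* `resid V : Ω → Ωv` — the residue map as a total function (junk value `0` off `V`), with its
  algebra on `V`. DEFINITION. [folklore]
* `IsLiftedFrobeniusClosedBasisRing V p K F R 𝓑` — (LFC1)–(LFC3) for subfields `K ≤ F` of the
  ambient valued field `(Ω, V)`, a subring `R` and a set `𝓑 ⊆ Ω`. DEFINITION, with API: `𝓑`
  consists of non-zero elements of `V`, `K`-linear combinations (`Finsupp.linearCombination`)
  lie in `R ⊆ F`, the `max` form of valuation independence (`exists_valuation_eq`,
  `valuation_coeff_le`), `K`-linear independence of `𝓑` (`linearIndependent`), residues of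
  linear combinations (`resid_linearCombination`), Lemma 4.8 (a) (`resid_pow_mem`,
  `eq_pow_of_resid_eq_pow`), the Frobenius map `frob` of `𝓑` and its injectivity, and
  Lemma 4.8 (b), (c) for the residues of `𝓑` (`exists_pow_eq_of_linearCombination_resid_eq_pow`,
  `exists_pow_eq_of_linearCombination_resid_eq_pow_sub`). PROVED.
* `Kuhlmann2010Lemma410` — NAMED FACT: Lemma 4.10 (the equal characteristic case of Lemma 4.7):
  for `F` in the class `IsHenselizedInertiallyGeneratedRT V K` over an algebraically closed `K`
  with `char Ω = char Ωv = p`, such `R`, `𝓑` exist.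

## Sources

* F.-V. Kuhlmann, *Elimination of ramification I: The generalized stability theorem*, Trans.
  Amer. Math. Soc. 362 (2010) 5697–5727 = arXiv:1003.5678: §2.4 (valuation independence),
  §4.2 (Lemmas 4.7–4.10; [K5] = F.-V. Kuhlmann, *Additive polynomials and their role in the
  model theory of valued fields*, Lect. Notes Log. 26 (2006), Thm. 10), §2.1 Lemma 2.4.

## Rendering notes

* "Valuation independent over `K`" (§2.4: "`v ∑ cᵢbᵢ = min vcᵢbᵢ`") is rendered
  multiplicatively as: every term `cᵤ·u` of a `K`-linear combination has value at most the
  value of the combination (`valuation_le`); the `max` form is `exists_valuation_eq`. A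
  "valuation basis" is a basis which is valuation independent; the `K`-linear independence is a
  consequence (`linearIndependent`), so the structure records spanning (`mem_span_iff`) and
  valuation independence.
* "Quot(`R`) is dense in `F`" is density for the valuation topology of the rank-one field
  `(F, v)`: every `a ∈ F` is approximated by elements of the subfield generated by `R` to
  within `vε` for every `ε ∈ F^×`.
* Residue fields: `K̄ = residueSubfield K V ≤ F̄ = residueSubfield F V ≤ Ωv`, residues through
  `resid V`; "`ūⱼ` form a basis of `F̄|K̄`" = `K̄`-linear independence of `u ↦ resid V u` on `𝓑`
  and `F̄ ⊆` its `K̄`-span.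
* Only the equal characteristic existence statement (Lemma 4.10) is vendored; the mixed
  characteristic one (Lemma 4.11, through a discretely valued subfield `K₀`) is left to the layer
  treating Prop. 4.13.
-/

noncomputable section

open IsLocalRing

namespace Literature.AlgebraicGeometry.Resolution

universe u

/-! ### Frobenius-closed linearly independent families (Lemma 4.8 (b), (c), abstract form) -/

section FrobeniusClosedFamilies

variable {ι k L : Type*} [Field k] [Field L] [Algebra k L] (p : ℕ) [hp : Fact p.Prime] [CharP L p]

/-- The `p`-th power of a linear combination of a Frobenius-closed family is the linear
combination, with `p`-th powers of the coefficients, of the `p`-th powers of the family.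
[folklore] -/
theorem linearCombination_pow_eq {b : ι → L} (φ : ι → ι) (hφ : ∀ i, b (φ i) = b i ^ p)
    (g : ι →₀ k) :
    (Finsupp.linearCombination k b g) ^ p =
      Finsupp.linearCombination k b
        (Finsupp.mapDomain φ (Finsupp.mapRange (fun c : k => c ^ p) (zero_pow hp.out.ne_zero) g)) := by
  classical
  haveI : ExpChar L p := ExpChar.prime hp.out
  rw [Finsupp.linearCombination_mapDomain, Finsupp.linearCombination_apply,
    Finsupp.linearCombination_apply, Finsupp.sum_mapRange_index (fun _ => by simp), Finsupp.sum,
    Finsupp.sum, sum_pow_char]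
  refine Finset.sum_congr rfl fun j _ => ?_
  rw [smul_pow, Function.comp_apply, hφ]

/-- **Kuhlmann 2010, Lemma 4.8 (b), abstract form**: for a `k`-linearly independent family
`b` in a field `L` of characteristic `p` which is Frobenius-closed (`b (φ i) = (b i)^p`), if a
linear combination `∑ fᵢ bᵢ` is the `p`-th power of a linear combination `∑ gⱼ bⱼ`, then every
`bᵢ` with `fᵢ ≠ 0` is the `p`-th power of a member of the family ("every `ūᵢ` which appears on
the left hand side … equals a `p`-th power `ūⱼ^p` appearing on the right hand side").
PROVED (uniqueness of coefficients). [cite: Kuhlmann2010, Lemma 4.8 (b)] -/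
theorem exists_apply_eq_of_linearCombination_eq_pow {b : ι → L} (hb : LinearIndependent k b)
    (φ : ι → ι) (hφ : ∀ i, b (φ i) = b i ^ p) (f g : ι →₀ k)
    (h : Finsupp.linearCombination k b f = (Finsupp.linearCombination k b g) ^ p) :
    ∀ i ∈ f.support, ∃ j, φ j = i := by
  classical
  rw [linearCombination_pow_eq p φ hφ g] at h
  have hfg := hb.finsuppLinearCombination_injective h
  intro i hi
  rw [hfg] at hi
  obtain ⟨j, -, rfl⟩ := Finset.mem_image.mp (Finsupp.mapDomain_support hi)
  exact ⟨j, rfl⟩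

/-- **Kuhlmann 2010, Lemma 4.8 (c), abstract form**: for a `k`-linearly independent
Frobenius-closed family `b` (with `φ` injective, i.e. distinct members have distinct `p`-th
powers) in a field of characteristic `p`, if `0 ≠ ∑ fᵢ bᵢ = ϑ^p - ϑ` for a linear combination
`ϑ = ∑ gⱼ bⱼ`, then some `bᵢ` with `fᵢ ≠ 0` is the `p`-th power of a member of the family
("Similar to b), hence left to the reader": otherwise, comparing coefficients, `g` would be
non-zero along the whole orbit `i₀, φ i₀, φ² i₀, …` of some `i₀` in the support of `f`, which
is infinite since `i₀` is not in the range of `φ`). PROVED. [cite: Kuhlmann2010, Lemma 4.8 (c)] -/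
theorem exists_apply_eq_of_linearCombination_eq_pow_sub {b : ι → L} (hb : LinearIndependent k b)
    (φ : ι → ι) (hφ : ∀ i, b (φ i) = b i ^ p) (hφinj : Function.Injective φ) (f g : ι →₀ k)
    (hf : f ≠ 0)
    (h : Finsupp.linearCombination k b f =
      (Finsupp.linearCombination k b g) ^ p - Finsupp.linearCombination k b g) :
    ∃ i ∈ f.support, ∃ j, φ j = i := by
  classical
  set g' : ι →₀ k :=
    Finsupp.mapDomain φ (Finsupp.mapRange (fun c : k => c ^ p) (zero_pow hp.out.ne_zero) g) with hg'
  rw [linearCombination_pow_eq p φ hφ g, ← hg', ← map_sub] at h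
  have hfg : f = g' - g := hb.finsuppLinearCombination_injective h
  by_contra hcon
  push Not at hcon
  obtain ⟨i₀, hi₀⟩ := Finsupp.support_nonempty_iff.mpr hf
  -- `g'` vanishes off the range of `φ`, and `g' (φ j) = (g j)^p`
  have hg'0 : ∀ i, (∀ j, φ j ≠ i) → g' i = 0 := fun i hi =>
    Finsupp.mapDomain_notin_range _ _ (by rintro ⟨j, rfl⟩; exact hi j rfl)
  have hg'φ : ∀ j, g' (φ j) = g j ^ p := fun j => by
    rw [hg', Finsupp.mapDomain_apply hφinj, Finsupp.mapRange_apply]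
  -- all iterates `φ^[n] i₀` lie in the support of `g`
  have hiter : ∀ n, g (φ^[n] i₀) ≠ 0 := by
    intro n
    induction n with
    | zero =>
      have h1 : f i₀ = g' i₀ - g i₀ := by rw [hfg, Finsupp.sub_apply]
      rw [hg'0 i₀ (hcon i₀ hi₀), zero_sub] at h1
      rw [Function.iterate_zero, id_eq]
      intro h0
      rw [h0, neg_zero] at h1
      exact (Finsupp.mem_support_iff.mp hi₀) h1
    | succ n ih =>
      have hj : f (φ^[n + 1] i₀) = 0 := by
        by_contra hne
        exact hcon _ (Finsupp.mem_support_iff.mpr hne) (φ^[n] i₀)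
          (Function.iterate_succ_apply' φ n i₀).symm
      rw [hfg, Finsupp.sub_apply, Function.iterate_succ_apply', hg'φ, sub_eq_zero] at hj
      rw [Function.iterate_succ_apply', ← hj]
      exact pow_ne_zero _ ih
  -- pigeonhole: the orbit is eventually periodic, so `i₀` is in the range of `φ`
  let G : ℕ → g.support := fun n => ⟨φ^[n] i₀, Finsupp.mem_support_iff.mpr (hiter n)⟩
  obtain ⟨n, m, hnm, hGnm⟩ := Finite.exists_ne_map_eq_of_infinite G
  have heq : φ^[n] i₀ = φ^[m] i₀ := congrArg Subtype.val hGnm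
  have key : ∀ n m : ℕ, n < m → φ^[n] i₀ = φ^[m] i₀ → False := by
    intro n m hlt he
    obtain ⟨d, rfl⟩ := Nat.exists_eq_add_of_lt hlt
    have h2 : φ^[n] i₀ = φ^[n] (φ^[d + 1] i₀) := by
      rw [he, ← Function.iterate_add_apply, Nat.add_assoc]
    have hi : i₀ = φ^[d + 1] i₀ := hφinj.iterate n h2
    rw [Function.iterate_succ_apply'] at hi
    exact hcon i₀ hi₀ (φ^[d] i₀) hi.symm
  rcases lt_or_gt_of_ne hnm with hlt | hlt
  · exact key n m hlt heq
  · exact key m n hlt heq.symm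

end FrobeniusClosedFamilies

/-! ### The residue map on `Ω` (junk value `0` off `V`) -/

section Resid

variable {Ω : Type u} [Field Ω] (V : ValuationSubring Ω)

/-- The residue map of `(Ω, V)` as a total function on `Ω`: the residue of `a ∈ V`, and the
junk value `0` for `a ∉ V`. [folklore] -/
def resid (a : Ω) : ResidueField V :=
  haveI := Classical.propDecidable (a ∈ V)
  if h : a ∈ V then residue V ⟨a, h⟩ else 0

/-- `resid` on `V` is the residue map. [folklore] -/
theorem resid_of_mem {a : Ω} (h : a ∈ V) : resid V a = residue V ⟨a, h⟩ := by
  unfold resid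
  exact dif_pos h

/-- `resid` off `V` is `0`. [folklore] -/
theorem resid_of_not_mem {a : Ω} (h : a ∉ V) : resid V a = 0 := by
  unfold resid
  exact dif_neg h

/-- `resid` on an element of `V`. [folklore] -/
theorem resid_coe (a : V) : resid V (a : Ω) = residue V a := by
  rw [resid_of_mem V a.2]

/-- `resid 0 = 0`. [folklore] -/
@[simp] theorem resid_zero : resid V (0 : Ω) = 0 := by
  rw [resid_of_mem V (zero_mem V)]
  exact map_zero (residue V)

/-- `resid 1 = 1`. [folklore] -/
@[simp] theorem resid_one : resid V (1 : Ω) = 1 := by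
  rw [resid_of_mem V (one_mem V)]
  exact map_one (residue V)

/-- `resid` is additive on `V`. [folklore] -/
theorem resid_add {a b : Ω} (ha : a ∈ V) (hb : b ∈ V) : resid V (a + b) = resid V a + resid V b := by
  rw [resid_of_mem V ha, resid_of_mem V hb, resid_of_mem V (add_mem ha hb), ← map_add]
  rfl

/-- `resid` is multiplicative on `V`. [folklore] -/
theorem resid_mul {a b : Ω} (ha : a ∈ V) (hb : b ∈ V) : resid V (a * b) = resid V a * resid V b := by
  rw [resid_of_mem V ha, resid_of_mem V hb, resid_of_mem V (mul_mem ha hb), ← map_mul]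
  rfl

/-- `resid` commutes with negation on `V`. [folklore] -/
theorem resid_neg {a : Ω} (ha : a ∈ V) : resid V (-a) = -resid V a := by
  rw [resid_of_mem V ha, resid_of_mem V (neg_mem ha), ← map_neg]
  rfl

/-- `resid` commutes with subtraction on `V`. [folklore] -/
theorem resid_sub {a b : Ω} (ha : a ∈ V) (hb : b ∈ V) : resid V (a - b) = resid V a - resid V b := by
  rw [sub_eq_add_neg, resid_add V ha (neg_mem hb), resid_neg V hb, sub_eq_add_neg]

/-- `resid` commutes with powers on `V`. [folklore] -/
theorem resid_pow {a : Ω} (ha : a ∈ V) (n : ℕ) : resid V (a ^ n) = resid V a ^ n := by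
  rw [resid_of_mem V ha, resid_of_mem V (pow_mem ha n), ← map_pow]
  rfl

/-- `resid` commutes with finite sums of elements of `V`. [folklore] -/
theorem resid_sum {ι : Type*} (s : Finset ι) (f : ι → Ω) (h : ∀ i ∈ s, f i ∈ V) :
    resid V (∑ i ∈ s, f i) = ∑ i ∈ s, resid V (f i) := by
  classical
  induction s using Finset.induction_on with
  | empty => simp
  | insert i s hi ih =>
    rw [Finset.sum_insert hi, Finset.sum_insert hi,
      resid_add V (h i (Finset.mem_insert_self i s))
        (sum_mem fun j hj => h j (Finset.mem_insert_of_mem hj)),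
      ih fun j hj => h j (Finset.mem_insert_of_mem hj)]

/-- `resid a = 0` iff `a` has value `< 1`, for `a ∈ V`. [folklore] -/
theorem resid_eq_zero_iff {a : Ω} (ha : a ∈ V) : resid V a = 0 ↔ V.valuation a < 1 := by
  rw [resid_of_mem V ha, residue_eq_zero_iff, ValuationSubring.valuation_lt_one_iff]

/-- `resid a ≠ 0` iff `a` has value `1`, for `a ∈ V`. [folklore] -/
theorem resid_ne_zero_iff {a : Ω} (ha : a ∈ V) : resid V a ≠ 0 ↔ V.valuation a = 1 := by
  rw [Ne, resid_eq_zero_iff V ha, not_lt]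
  exact ⟨fun h => le_antisymm (V.valuation_le_one ⟨a, ha⟩) h, fun h => h.ge⟩

/-- Residues of elements of a subfield `F` lie in `Fv`. [folklore] -/
theorem resid_mem_residueSubfield {F : Subfield Ω} {a : Ω} (haF : a ∈ F) :
    resid V a ∈ residueSubfield F V := by
  by_cases ha : a ∈ V
  · rw [resid_of_mem V ha, residueSubfield_subfield_eq_resField]
    exact residue_mem_resField V ⟨a, ha⟩ haF
  · rw [resid_of_not_mem V ha]
    exact zero_mem _

/-- Every element of `Fv` is the residue of an element of `V ∩ F`. [folklore] -/
theorem exists_resid_eq_of_mem_residueSubfield {F : Subfield Ω} {r : ResidueField V}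
    (hr : r ∈ residueSubfield F V) : ∃ a ∈ F, a ∈ V ∧ resid V a = r := by
  rw [residueSubfield_subfield_eq_resField] at hr
  obtain ⟨a, haF, rfl⟩ := (mem_resField_iff V F r).mp hr
  exact ⟨a, haF, a.2, resid_coe V a⟩

/-- `v(a - b) < 1` iff `resid a = resid b`, for `a, b ∈ V`. [folklore] -/
theorem resid_eq_resid_iff {a b : Ω} (ha : a ∈ V) (hb : b ∈ V) :
    resid V a = resid V b ↔ V.valuation (a - b) < 1 := by
  rw [← sub_eq_zero, ← resid_sub V ha hb, resid_eq_zero_iff V (sub_mem ha hb)]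

end Resid

/-! ### Lifted Frobenius-closed bases (Lemma 4.7, (LFC1)–(LFC3)) -/

section LFC

variable {Ω : Type u} [Field Ω] (V : ValuationSubring Ω)

/-- **A subring `R ⊆ F` with a lifting `𝓑` of a Frobenius-closed basis** (Kuhlmann 2010,
Lemma 4.7 / Axiom 1, for a henselized function field `(F|K,v)`):
"(LFC1) `R` contains `K` and its quotient field Quot(`R`) is dense in `F`,
 (LFC2) `R` admits a valuation basis `𝓑 = {uⱼ | j ∈ J}` over `K` of elements of value `0` and
 containing the element `1`, whose residues `ūⱼ`, `j ∈ J`, form a basis of `F̄|K̄`,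
 (LFC3) `𝓑` is Frobenius-closed",
"Frobenius-closed, i.e., the `p`-th power of every element in `𝓑` lies again in `𝓑`" (§4.2);
"valuation independent" (§2.4): "`v ∑ cᵢbᵢ = min vcᵢbᵢ`" for `cᵢ ∈ K` and distinct `bᵢ ∈ 𝓑`, a
valuation basis being a basis which is a valuation independent set. Ambient rendering inside
`(Ω, V)`: `K ≤ F` subfields of `Ω`, `R` a subring of `Ω`, `𝓑 = B ⊆ Ω`; "Quot(`R`)" is the subfield
generated by `R`; "dense in `F`" is density for the valuation topology of `(F, v)`: every `a ∈ F`
is approximated by elements `q` of Quot(`R`) to within any value `vε`, `ε ∈ F^×`; linear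
combinations over `K` are `Finsupp.linearCombination K ((↑) : B → Ω)` for the `K`-module `Ω`;
residues are taken with `resid V` and the residue fields are `K̄ = residueSubfield K V ≤ F̄ =
residueSubfield F V ≤ Ωv`. (The `K`-linear independence of `B`, part of "basis", follows from
valuation independence: `IsLiftedFrobeniusClosedBasisRing.linearIndependent`.)
[cite: Kuhlmann2010, Lemma 4.7 ((LFC1)–(LFC3)), Section 2.4 and Section 4.2] -/
structure IsLiftedFrobeniusClosedBasisRing (p : ℕ) (K F : Subfield Ω) (R : Subring Ω) (B : Set Ω) :
    Prop where
  /-- (LFC1) `K ⊆ R`. -/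
  subfield_le : K.toSubring ≤ R
  /-- `R ⊆ F`. -/
  le_subfield : R ≤ F.toSubring
  /-- (LFC1) Quot(`R`) is dense in `F`. -/
  dense : ∀ a ∈ F, ∀ ε ∈ F, ε ≠ 0 →
    ∃ q ∈ Subfield.closure (R : Set Ω), V.valuation (a - q) < V.valuation ε
  /-- (LFC2) `𝓑 ⊆ R`. -/
  subset : B ⊆ R
  /-- (LFC2) `1 ∈ 𝓑`. -/
  one_mem : (1 : Ω) ∈ B
  /-- (LFC2) the elements of `𝓑` have value `0`. -/
  valuation_eq_one : ∀ u ∈ B, V.valuation u = 1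
  /-- (LFC2) `𝓑` spans `R` over `K` (exactly). -/
  mem_span_iff : ∀ r : Ω, r ∈ Submodule.span K B ↔ r ∈ R
  /-- (LFC2) `𝓑` is valuation independent over `K`: the value of a `K`-linear combination is the
  maximum of the values of its terms. -/
  valuation_le : ∀ f : B →₀ K, ∀ u ∈ f.support,
    V.valuation ((f u : Ω) * u) ≤ V.valuation (Finsupp.linearCombination K ((↑) : B → Ω) f)
  /-- (LFC2) the residues `ū`, `u ∈ 𝓑`, are `K̄`-linearly independent … -/
  resid_linearIndependent :
    LinearIndependent (residueSubfield K V) (fun u : B => resid V (u : Ω))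
  /-- … and span `F̄` over `K̄`. -/
  resid_span : ∀ r ∈ residueSubfield F V,
    r ∈ Submodule.span (residueSubfield K V) (Set.range fun u : B => resid V (u : Ω))
  /-- (LFC3) `𝓑` is Frobenius-closed. -/
  pow_mem : ∀ u ∈ B, u ^ p ∈ B

namespace IsLiftedFrobeniusClosedBasisRing

variable {V} {p : ℕ} {K F : Subfield Ω} {R : Subring Ω} {B : Set Ω}
variable (h : IsLiftedFrobeniusClosedBasisRing V p K F R B)
include h

/-- `K ≤ F`. [folklore] -/
theorem subfield_le_subfield : K ≤ F := fun _ hc => h.le_subfield (h.subfield_le hc)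

/-- `𝓑 ⊆ F`. [folklore] -/
theorem subset_subfield : B ⊆ F := fun _ hu => h.le_subfield (h.subset hu)

/-- Elements of `𝓑` lie in `V`. [folklore] -/
theorem mem_valuationSubring {u : Ω} (hu : u ∈ B) : u ∈ V :=
  (V.valuation_le_one_iff u).mp (h.valuation_eq_one u hu).le

/-- Elements of `𝓑` are non-zero. [folklore] -/
theorem ne_zero {u : Ω} (hu : u ∈ B) : u ≠ 0 := by
  intro h0
  have := h.valuation_eq_one u hu
  rw [h0, map_zero] at this
  exact zero_ne_one this

/-- `R ⊆` Quot(`R`) `⊆ F`. [folklore] -/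
theorem closure_le : Subfield.closure (R : Set Ω) ≤ F :=
  Subfield.closure_le.mpr fun _ hr => h.le_subfield hr

omit h in
/-- A `K`-linear combination of `𝓑`, written as a sum. [folklore] -/
theorem linearCombination_eq_sum (f : B →₀ K) :
    Finsupp.linearCombination K ((↑) : B → Ω) f = ∑ u ∈ f.support, (f u : Ω) * u := by
  rw [Finsupp.linearCombination_apply, Finsupp.sum]
  refine Finset.sum_congr rfl fun u _ => ?_
  rw [Algebra.smul_def]
  rfl

/-- `K`-linear combinations of `𝓑` lie in `R`. [folklore] -/
theorem linearCombination_mem (f : B →₀ K) : Finsupp.linearCombination K ((↑) : B → Ω) f ∈ R := by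
  rw [← h.mem_span_iff]
  have h1 : Finsupp.linearCombination K ((↑) : B → Ω) f ∈
      Submodule.span K (Set.range ((↑) : B → Ω)) :=
    Finsupp.mem_span_range_iff_exists_finsupp.mpr ⟨f, by rw [Finsupp.linearCombination_apply]⟩
  rwa [Subtype.range_coe] at h1

/-- `K`-linear combinations of `𝓑` lie in `F`. [folklore] -/
theorem linearCombination_mem_subfield (f : B →₀ K) :
    Finsupp.linearCombination K ((↑) : B → Ω) f ∈ F :=
  h.le_subfield (h.linearCombination_mem f)

/-- Every element of `R` is a `K`-linear combination of `𝓑`. [folklore] -/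
theorem exists_linearCombination_eq {r : Ω} (hr : r ∈ R) :
    ∃ f : B →₀ K, Finsupp.linearCombination K ((↑) : B → Ω) f = r := by
  have hr' : r ∈ Submodule.span K (Set.range ((↑) : B → Ω)) := by
    rw [Subtype.range_coe]
    exact (h.mem_span_iff r).mpr hr
  obtain ⟨f, hf⟩ := Finsupp.mem_span_range_iff_exists_finsupp.mp hr'
  exact ⟨f, by rw [Finsupp.linearCombination_apply]; exact hf⟩

/-- **Valuation independence, `max` form**: the value of a non-zero `K`-linear combination of `𝓑`
is the value of its largest coefficient, attained at some `u` in the support. [folklore] -/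
theorem exists_valuation_eq (f : B →₀ K) (hf : f ≠ 0) :
    ∃ u ∈ f.support, V.valuation (Finsupp.linearCombination K ((↑) : B → Ω) f) = V.valuation (f u : Ω) ∧
      ∀ w ∈ f.support, V.valuation (f w : Ω) ≤ V.valuation (f u : Ω) := by
  classical
  obtain ⟨u, hu, hmax⟩ := Finset.exists_max_image f.support (fun w => V.valuation (f w : Ω))
    (Finsupp.support_nonempty_iff.mpr hf)
  refine ⟨u, hu, le_antisymm ?_ ?_, hmax⟩
  · -- ultrametric inequality
    rw [linearCombination_eq_sum (K := K)]
    refine V.valuation.map_sum_le fun w hw => ?_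
    rw [map_mul, h.valuation_eq_one w w.2, mul_one]
    exact hmax w hw
  · have := h.valuation_le f u hu
    rwa [map_mul, h.valuation_eq_one u u.2, mul_one] at this

/-- The value of a `K`-linear combination of `𝓑` bounds the values of all its coefficients.
[folklore] -/
theorem valuation_coeff_le (f : B →₀ K) (u : B) :
    V.valuation (f u : Ω) ≤ V.valuation (Finsupp.linearCombination K ((↑) : B → Ω) f) := by
  by_cases hu : u ∈ f.support
  · have := h.valuation_le f u hu
    rwa [map_mul, h.valuation_eq_one u u.2, mul_one] at this
  · rw [Finsupp.notMem_support_iff.mp hu]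
    simp

/-- **`𝓑` is `K`-linearly independent** (valuation independence forces it: a vanishing
combination has all coefficients of value `≤ v0`). [cite: Kuhlmann2010, Section 2.4] -/
theorem linearIndependent : LinearIndependent K ((↑) : B → Ω) := by
  rw [linearIndependent_iff]
  intro f hf
  ext u
  have h1 := h.valuation_coeff_le f u
  rw [hf, map_zero, le_zero_iff, map_eq_zero] at h1
  exact_mod_cast h1

/-- A `K`-linear combination of `𝓑` with coefficients of value `≤ 1` lies in `V`. [folklore] -/
theorem linearCombination_mem_valuationSubring (f : B →₀ K) (hf : ∀ u, V.valuation (f u : Ω) ≤ 1) :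
    Finsupp.linearCombination K ((↑) : B → Ω) f ∈ V := by
  rw [← V.valuation_le_one_iff, linearCombination_eq_sum (K := K)]
  refine V.valuation.map_sum_le fun w _ => ?_
  rw [map_mul, h.valuation_eq_one w w.2, mul_one]
  exact hf w

/-- **The residue of a `K`-linear combination of `𝓑` with coefficients in `V`** is the
`K̄`-linear combination of the residues with the residues of the coefficients. [folklore] -/
theorem resid_linearCombination (f : B →₀ K) (hf : ∀ u, (f u : Ω) ∈ V) :
    resid V (Finsupp.linearCombination K ((↑) : B → Ω) f) =
      ∑ u ∈ f.support, resid V (f u : Ω) * resid V (u : Ω) := by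
  rw [linearCombination_eq_sum (K := K), resid_sum V _ _ fun u _ => mul_mem (hf u) (h.mem_valuationSubring u.2)]
  refine Finset.sum_congr rfl fun u _ => ?_
  rw [resid_mul V (hf u) (h.mem_valuationSubring u.2)]

/-! #### Lemma 4.8 (a) -/

/-- **Kuhlmann 2010, Lemma 4.8 (a), first part**: the residues `ū`, `u ∈ 𝓑`, form a
Frobenius-closed family — `\overline{u^p} = ū^p` with `u^p ∈ 𝓑`. PROVED. [cite: Kuhlmann2010, Lemma 4.8 (a)] -/
theorem resid_pow_mem {u : Ω} (hu : u ∈ B) : resid V (u ^ p) = resid V u ^ p ∧ u ^ p ∈ B :=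
  ⟨resid_pow V (h.mem_valuationSubring hu) p, h.pow_mem u hu⟩

/-- Distinct elements of `𝓑` have distinct residues (the residue family is linearly
independent, hence injective). [folklore] -/
theorem resid_injective {u w : Ω} (hu : u ∈ B) (hw : w ∈ B) (huw : resid V u = resid V w) : u = w := by
  have hinj := h.resid_linearIndependent.injective
  have := @hinj ⟨u, hu⟩ ⟨w, hw⟩ huw
  exact congrArg Subtype.val this

/-- **Kuhlmann 2010, Lemma 4.8 (a), second part**: "If `ū_m = ū_n^p` then `u_m = u_n^p`"
(`u_n^p ∈ 𝓑` has the same residue as `u_m`; distinct basis elements have distinct — indeed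
linearly independent — residues). PROVED. [cite: Kuhlmann2010, Lemma 4.8 (a)] -/
theorem eq_pow_of_resid_eq_pow {u w : Ω} (hu : u ∈ B) (hw : w ∈ B)
    (huw : resid V u = resid V w ^ p) : u = w ^ p :=
  h.resid_injective hu (h.pow_mem w hw) (by rw [huw, (h.resid_pow_mem hw).1])

/-- The Frobenius map of `𝓑`: `u ↦ u^p`. [folklore] -/
def frob (u : B) : B := ⟨(u : Ω) ^ p, h.pow_mem u u.2⟩

/-- `frob u = u^p` in `Ω`. [folklore] -/
@[simp] theorem coe_frob (u : B) : ((h.frob u : B) : Ω) = (u : Ω) ^ p := rfl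

/-- The residue of `frob u` is `ū^p`. [folklore] -/
theorem resid_frob (u : B) : resid V ((h.frob u : B) : Ω) = resid V (u : Ω) ^ p := by
  rw [h.coe_frob, resid_pow V (h.mem_valuationSubring u.2)]

/-- The Frobenius map of `𝓑` is injective when `char Ωv = p` (residues are injective on `𝓑` and
Frobenius is injective on `Ωv`). [folklore] -/
theorem frob_injective [hp : Fact p.Prime] [CharP (ResidueField V) p] : Function.Injective h.frob := by
  intro u w huw
  have h1 : resid V (u : Ω) ^ p = resid V (w : Ω) ^ p := by
    rw [← h.resid_frob, ← h.resid_frob, huw]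
  have h2 : resid V (u : Ω) = resid V (w : Ω) := frobenius_inj (ResidueField V) p h1
  exact Subtype.ext (h.resid_injective u.2 w.2 h2)

/-! #### Lemma 4.8 (b), (c) for `𝓑` -/

/-- **Kuhlmann 2010, Lemma 4.8 (b)** for the residues of a lifted Frobenius-closed basis: if a
`K̄`-linear combination `∑ c̄ᵤ ū` of the residues is a `p`-th power in `F̄`, then every `u ∈ 𝓑`
with `c̄ᵤ ≠ 0` is the `p`-th power of an element of `𝓑`. PROVED from the abstract form and
Lemma 4.8 (a). [cite: Kuhlmann2010, Lemma 4.8 (b)] -/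
theorem exists_pow_eq_of_linearCombination_resid_eq_pow [hp : Fact p.Prime] [CharP (ResidueField V) p]
    (e : B →₀ residueSubfield K V) {w : ResidueField V} (hw : w ∈ residueSubfield F V)
    (heq : Finsupp.linearCombination (residueSubfield K V) (fun u : B => resid V (u : Ω)) e = w ^ p) :
    ∀ u ∈ e.support, ∃ w' ∈ B, w' ^ p = (u : Ω) := by
  obtain ⟨g, hg⟩ := Finsupp.mem_span_range_iff_exists_finsupp.mp (h.resid_span w hw)
  rw [← Finsupp.linearCombination_apply] at hg
  rw [← hg] at heq
  intro u hu
  obtain ⟨j, hj⟩ := exists_apply_eq_of_linearCombination_eq_pow p h.resid_linearIndependent h.frob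
    h.resid_frob e g heq u hu
  exact ⟨j, j.2, by rw [← hj]; rfl⟩

/-- **Kuhlmann 2010, Lemma 4.8 (c)** for the residues of a lifted Frobenius-closed basis: if
`0 ≠ ϑ̄^p - ϑ̄ = ∑ c̄ᵤ ū` with `ϑ̄ ∈ F̄`, then some `u ∈ 𝓑` with `c̄ᵤ ≠ 0` is the `p`-th power of an
element of `𝓑`. PROVED from the abstract form. [cite: Kuhlmann2010, Lemma 4.8 (c)] -/
theorem exists_pow_eq_of_linearCombination_resid_eq_pow_sub [hp : Fact p.Prime] [CharP (ResidueField V) p]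
    (e : B →₀ residueSubfield K V) (he : e ≠ 0) {ϑ : ResidueField V} (hϑ : ϑ ∈ residueSubfield F V)
    (heq : Finsupp.linearCombination (residueSubfield K V) (fun u : B => resid V (u : Ω)) e = ϑ ^ p - ϑ) :
    ∃ u ∈ e.support, ∃ w' ∈ B, w' ^ p = (u : Ω) := by
  obtain ⟨g, hg⟩ := Finsupp.mem_span_range_iff_exists_finsupp.mp (h.resid_span ϑ hϑ)
  rw [← Finsupp.linearCombination_apply] at hg
  rw [← hg] at heq
  obtain ⟨u, hu, j, hj⟩ := exists_apply_eq_of_linearCombination_eq_pow_sub p h.resid_linearIndependent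
    h.frob h.resid_frob h.frob_injective e g he heq
  exact ⟨u, hu, j, j.2, by rw [← hj]; rfl⟩

end IsLiftedFrobeniusClosedBasisRing

end LFC

/-! ### Lemma 4.10 (with Lemma 4.7): existence in characteristic `p` (named fact) -/

/-- NAMED FACT — **Kuhlmann 2010, Lemma 4.10 (the case `char K = p` of Lemma 4.7): existence
of a subring with a lifting of a Frobenius-closed basis, for the fields of the class over an
algebraically closed `K` of characteristic `p`.** Lemma 4.7: "Let `(F|K,v)` be a henselized
inertially generated function field of rank `1` and transcendence degree `1` with a
residue-transcendental generator. Further, assume that `K̄` is perfect of characteristic `p > 0`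
and relatively algebraically closed in `F̄`, and that `K` is of arbitrary characteristic and
closed under `p`-th roots. Then `F` contains a subring `R` which satisfies: (LFC1) …, (LFC2) …,
(LFC3) …" (`IsLiftedFrobeniusClosedBasisRing`); Lemma 4.10: "In the case of `char K = p` there
exists an embedding of the residue field `F̄` in `F` respecting the residue map such that
`K̄ = K ∩ F̄`, that `K` is linearly disjoint from `F̄` over `K̄` and that `F = (K.F̄)^h`. The ring
`R = K[F̄] ⊂ F` satisfies properties (LFC1), (LFC2) and (LFC3)" (with a Frobenius-closed basis
of `F̄|K̄`, which exists by [K5] Thm. 10 since `K̄` is perfect and relatively algebraically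
closed in the function field `F̄` of transcendence degree `1`; the density in (LFC1) is
Lemma 2.4, rank one). Rendering: `(Ω, V)` algebraically closed with `char Ω = char Ωv = p > 0`,
`K ≤ Ω` a subfield which is an algebraically closed field (so `K̄` is algebraically closed —
perfect and relatively algebraically closed in `F̄` — and `K` is perfect), `F` in the class
`IsHenselizedInertiallyGeneratedRT V K` (rank one, transcendence degree one,
residue-transcendental generator); then there are a subring `R` and a set `𝓑` with
`IsLiftedFrobeniusClosedBasisRing V p K F R 𝓑`. Only the equal characteristic case is vendored
here (the mixed characteristic construction is Lemma 4.11). Not in Mathlib. Users take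
`(h : Kuhlmann2010Lemma410)`. [cite: Kuhlmann2010, Lemma 4.10 (with Lemma 4.7 and Lemma 2.4)] -/
def Kuhlmann2010Lemma410 : Prop :=
  ∀ (Ω : Type u) [Field Ω] [IsAlgClosed Ω] (V : ValuationSubring Ω) (p : ℕ)
    [CharP (ResidueField V) p] [CharP Ω p],
    p.Prime → ∀ (K F : Subfield Ω), IsAlgClosed K → IsHenselizedInertiallyGeneratedRT V K F →
    ∃ (R : Subring Ω) (B : Set Ω), IsLiftedFrobeniusClosedBasisRing V p K F R B

end Literature.AlgebraicGeometry.Resolution
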